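import Mathlib
import HarnessLib
import Summits.HubbardSuperconductivity.HubbardSuperconductivity.Theorems.KLProgrammeC4aPairDiffJetsL1
import Summits.HubbardSuperconductivity.HubbardSuperconductivity.Theorems.KLProgrammePerturbedFermiCurveTwoFrameTower3
import Summits.HubbardSuperconductivity.HubbardSuperconductivity.Theorems.KLProgrammePerturbedFermiCurveHigherDerivsFrame

/-!
# Route `KLProgramme` — crux C4a, (L3) the RADIAL ROWS OF ORDERS TWO AND THREE of the co-moving chart (the `hrow₂`, `hrow₃` inputs of
# `coMovingJetsL1_pairSum/pairDiff_of_inversePower`)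

Cell `gate-hubbard-kl`, lane hubbard-kl-c4a-1 (g5); helper for stub (C) `stub_twoLeg_curvature` of the engine-flow child `KLRegimeEngineV17F2`
(stmt-HubbardSuperconductivity-20437); memo HOME/hubbard-kl-c4a-1/C4A-PLAN.md §22.6–22.7 (α).  The two curves `γ₀` (level `μ`) and `γ_ρ` (level `μ + ρ`) are polar
level curves of the SAME `C⁴` function `e_K = ε₀ + δ_K` at two levels, so k3c3-p3's two-curve tower (`abs_deriv_two/three_sub_le_of_polar_levels`,
`…PerturbedFermiCurveTwoFrameTower[3]`) applies with `e' = e`: the derivative differences `Δ_j = ‖Dʲe(γ_ρ-point) − Dʲe(γ₀-point)‖` are `≤ sup‖D^{j+1}e_K‖·|u_ρ − u₀|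
≤ (4 + 2^{j+1}A_{j+1})·|ρ|/(Dt_min − 2A)` (global sizes of `ε₀` and of the frame, mean value theorem), the radius/derivative sizes are the window tower
(`frameRadius_tower_of_sizes`), `W₀ = |ρ|/(Dt_min−2A)`, `W₁` is `…C4aRadialRowOne`.  Hence `|u″(μ+ρ;s) − u″(μ;s)| ≤ uRowTwoConst·|ρ|`,
`|u‴(μ+ρ;s) − u‴(μ;s)| ≤ uRowThreeConst·|ρ|`, and through the moving-frame formulas `γ″ = (u″−u)d₀ + 2u′d₁`, `γ‴ = (u‴−3u′)d₀ + (3u″−u)d₁` the curve rows.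

* §1 global derivative sizes / Lipschitz constants of `e_K` (`norm_fderiv[_two,_three]_pertBandK_sub_le`);
* §2 `uRowTwoConst`, `uRowThreeConst` (defs), **`abs_deriv_two_frameRadius_level_sub_le`**, **`abs_deriv_three_frameRadius_level_sub_le`**;
* §3 `iteratedDeriv_two/three_levelPoint` (moving-frame closed forms), `curveRowTwoConst`, `curveRowThreeConst` (defs),
  **`norm_iteratedDeriv_two_levelPoint_sub_le`**, **`norm_iteratedDeriv_three_levelPoint_sub_le`** — the hypotheses `hrow₂`, `hrow₃` of
  `coMovingJetsL1_pairSum/pairDiff_of_inversePower`;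
(The companion `…C4aPairJetsL1Discharged` plugs these rows into `coMovingJetsL1_pairSum/pairDiff_of_inversePower`.)

Proved calculus keyed by the frame's sizes as `…C4aPathJets`; nothing about the Hubbard model's sizes; nothing asserts superconductivity.
References: BGM 2006 §2.4 Lemma 2.1 (2.40)–(2.41) [cite: BenfattoGiulianiMastropietro2006]; FST IV CPAM 53 (2000) Thm 2; FST II CPAM 51 (1998) §3.
-/

noncomputable section

namespace Summit.HubbardSuperconductivity.HubbardSuperconductivity.Theorems.C4a

set_option linter.dupNamespace false -- summit = problem name (single-conjunct summit), D-0017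
set_option maxSynthPendingDepth 3 -- nested operator-norm instances (third/fourth Fréchet derivatives)

open Real Set MeasureTheory Finset
open scoped ContDiff
open Literature.MathematicalPhysics.QuantumLattice Literature.MathematicalPhysics.QuantumLattice.BandSectorCounting Literature.Probability.LatticeModels
open Summit.HubbardSuperconductivity.HubbardSuperconductivity.Theorems.KLRegimeSplit
open Summit.HubbardSuperconductivity.HubbardSuperconductivity.Theorems.DispersionFlow
open Summit.HubbardSuperconductivity.HubbardSuperconductivity.Theorems.PerturbedFermiCurve

/-! ## §1 Global derivative sizes and Lipschitz constants of `e_K = ε₀ + δ_K` -/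

section Global

variable {K : TrigPolyC4v}

/-- `e_K` is `C⁴`. -/
theorem contDiff_pertBandK (K : TrigPolyC4v) : ContDiff ℝ 4 (fun k : Fin 2 → ℝ => sqDispersion k + (fun p : Fin 2 → ℝ => -K.eval p) k) := by
  refine contDiff_pertBand ?_
  rw [← frameShift_toLp_eq_neg_eval]; exact contDiff_frameShift_toLp K

/-- Global: `‖D²e_K(z)‖ ≤ 4 + 4A`. -/
theorem norm_fderiv_two_pertBandK_le {A : ℝ} (hA : ∀ p : Momentum, ∀ j ≤ 2, ‖iteratedFDeriv ℝ j (frameShift K) p‖ ≤ A) (z : Fin 2 → ℝ) :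
    ‖fderiv ℝ (fderiv ℝ (fun k : Fin 2 → ℝ => sqDispersion k + (fun p : Fin 2 → ℝ => -K.eval p) k)) z‖ ≤ 4 + 4 * A := by
  have hC : ContDiff ℝ 4 (fun p : Fin 2 → ℝ => -K.eval p) := by rw [← frameShift_toLp_eq_neg_eval]; exact contDiff_frameShift_toLp K
  rw [norm_fderiv_two_eq_norm_iteratedFDeriv,
    show (fun k : Fin 2 → ℝ => sqDispersion k + (fun p : Fin 2 → ℝ => -K.eval p) k) = sqDispersion + (fun p : Fin 2 → ℝ => -K.eval p) from rfl,
    iteratedFDeriv_add_apply contDiff_sqDispersion.contDiffAt (hC.of_le (by norm_num)).contDiffAt]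
  refine (norm_add_le _ _).trans (add_le_add (norm_iteratedFDeriv_sqDispersion_le 2 _) ?_)
  rw [← frameShift_toLp_eq_neg_eval]
  have h := norm_iteratedFDeriv_frameShift_toLp_le hA z (j := 2) le_rfl
  linarith

/-- Global: `‖D³e_K(z)‖ ≤ 4 + 8A₃`. -/
theorem norm_fderiv_three_pertBandK_le {A₃ : ℝ} (hA₃ : ∀ p : Momentum, ‖iteratedFDeriv ℝ 3 (frameShift K) p‖ ≤ A₃) (z : Fin 2 → ℝ) :
    ‖fderiv ℝ (fderiv ℝ (fderiv ℝ (fun k : Fin 2 → ℝ => sqDispersion k + (fun p : Fin 2 → ℝ => -K.eval p) k))) z‖ ≤ 4 + 8 * A₃ := by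
  have hC : ContDiff ℝ 4 (fun p : Fin 2 → ℝ => -K.eval p) := by rw [← frameShift_toLp_eq_neg_eval]; exact contDiff_frameShift_toLp K
  rw [norm_fderiv_three_eq_norm_iteratedFDeriv,
    show (fun k : Fin 2 → ℝ => sqDispersion k + (fun p : Fin 2 → ℝ => -K.eval p) k) = sqDispersion + (fun p : Fin 2 → ℝ => -K.eval p) from rfl,
    iteratedFDeriv_add_apply contDiff_sqDispersion.contDiffAt (hC.of_le (by norm_num)).contDiffAt]
  refine (norm_add_le _ _).trans (add_le_add (norm_iteratedFDeriv_sqDispersion_le 3 _) ?_)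
  rw [← norm_fderiv_three_eq_norm_iteratedFDeriv]
  exact norm_fderiv_three_frameShift_le hA₃ z

/-- Global: `‖D⁴e_K(z)‖ ≤ 4 + 16A₄`. -/
theorem norm_fderiv_four_pertBandK_le {A₄ : ℝ} (hA₄ : ∀ p : Momentum, ‖iteratedFDeriv ℝ 4 (frameShift K) p‖ ≤ A₄) (z : Fin 2 → ℝ) :
    ‖fderiv ℝ (fderiv ℝ (fderiv ℝ (fderiv ℝ (fun k : Fin 2 → ℝ => sqDispersion k + (fun p : Fin 2 → ℝ => -K.eval p) k)))) z‖ ≤ 4 + 16 * A₄ := by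
  have hC : ContDiff ℝ 4 (fun p : Fin 2 → ℝ => -K.eval p) := by rw [← frameShift_toLp_eq_neg_eval]; exact contDiff_frameShift_toLp K
  rw [norm_fderiv_four_eq_norm_iteratedFDeriv,
    show (fun k : Fin 2 → ℝ => sqDispersion k + (fun p : Fin 2 → ℝ => -K.eval p) k) = sqDispersion + (fun p : Fin 2 → ℝ => -K.eval p) from rfl,
    iteratedFDeriv_add_apply contDiff_sqDispersion.contDiffAt hC.contDiffAt]
  refine (norm_add_le _ _).trans (add_le_add (norm_iteratedFDeriv_sqDispersion_le 4 _) ?_)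
  rw [← norm_fderiv_four_eq_norm_iteratedFDeriv]
  exact norm_fderiv_four_frameShift_le hA₄ z

/-- `De_K` is `(4 + 4A)`-Lipschitz. -/
theorem norm_fderiv_pertBandK_sub_le {A : ℝ} (hA : ∀ p : Momentum, ∀ j ≤ 2, ‖iteratedFDeriv ℝ j (frameShift K) p‖ ≤ A) (x y : Fin 2 → ℝ) :
    ‖fderiv ℝ (fun k : Fin 2 → ℝ => sqDispersion k + (fun p : Fin 2 → ℝ => -K.eval p) k) x -
        fderiv ℝ (fun k : Fin 2 → ℝ => sqDispersion k + (fun p : Fin 2 → ℝ => -K.eval p) k) y‖ ≤ (4 + 4 * A) * ‖x - y‖ := by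
  have he := contDiff_pertBandK K
  have hdiff : Differentiable ℝ (fderiv ℝ (fun k : Fin 2 → ℝ => sqDispersion k + (fun p : Fin 2 → ℝ => -K.eval p) k)) :=
    (he.fderiv_right (m := 3) (by norm_num)).differentiable (by norm_num)
  exact (convex_univ (𝕜 := ℝ) (E := Fin 2 → ℝ)).norm_image_sub_le_of_norm_fderiv_le (fun z _ => hdiff z)
    (fun z _ => norm_fderiv_two_pertBandK_le hA z) (mem_univ y) (mem_univ x)

/-- `D²e_K` is `(4 + 8A₃)`-Lipschitz. -/
theorem norm_fderiv_two_pertBandK_sub_le {A₃ : ℝ} (hA₃ : ∀ p : Momentum, ‖iteratedFDeriv ℝ 3 (frameShift K) p‖ ≤ A₃) (x y : Fin 2 → ℝ) :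
    ‖fderiv ℝ (fderiv ℝ (fun k : Fin 2 → ℝ => sqDispersion k + (fun p : Fin 2 → ℝ => -K.eval p) k)) x -
        fderiv ℝ (fderiv ℝ (fun k : Fin 2 → ℝ => sqDispersion k + (fun p : Fin 2 → ℝ => -K.eval p) k)) y‖ ≤ (4 + 8 * A₃) * ‖x - y‖ := by
  have he := contDiff_pertBandK K
  have hdiff : Differentiable ℝ (fderiv ℝ (fderiv ℝ (fun k : Fin 2 → ℝ => sqDispersion k + (fun p : Fin 2 → ℝ => -K.eval p) k))) :=
    ((he.fderiv_right (m := 3) (by norm_num)).fderiv_right (m := 2) (by norm_num)).differentiable (by norm_num)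
  exact (convex_univ (𝕜 := ℝ) (E := Fin 2 → ℝ)).norm_image_sub_le_of_norm_fderiv_le (fun z _ => hdiff z)
    (fun z _ => norm_fderiv_three_pertBandK_le hA₃ z) (mem_univ y) (mem_univ x)

/-- `D³e_K` is `(4 + 16A₄)`-Lipschitz. -/
theorem norm_fderiv_three_pertBandK_sub_le {A₄ : ℝ} (hA₄ : ∀ p : Momentum, ‖iteratedFDeriv ℝ 4 (frameShift K) p‖ ≤ A₄) (x y : Fin 2 → ℝ) :
    ‖fderiv ℝ (fderiv ℝ (fderiv ℝ (fun k : Fin 2 → ℝ => sqDispersion k + (fun p : Fin 2 → ℝ => -K.eval p) k))) x -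
        fderiv ℝ (fderiv ℝ (fderiv ℝ (fun k : Fin 2 → ℝ => sqDispersion k + (fun p : Fin 2 → ℝ => -K.eval p) k))) y‖ ≤
      (4 + 16 * A₄) * ‖x - y‖ := by
  have he := contDiff_pertBandK K
  have hdiff : Differentiable ℝ (fderiv ℝ (fderiv ℝ (fderiv ℝ (fun k : Fin 2 → ℝ => sqDispersion k + (fun p : Fin 2 → ℝ => -K.eval p) k)))) :=
    (((he.fderiv_right (m := 3) (by norm_num)).fderiv_right (m := 2) (by norm_num)).fderiv_right (m := 1) (by norm_num)).differentiable
      (by norm_num)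
  exact (convex_univ (𝕜 := ℝ) (E := Fin 2 → ℝ)).norm_image_sub_le_of_norm_fderiv_le (fun z _ => hdiff z)
    (fun z _ => norm_fderiv_four_pertBandK_le hA₄ z) (mem_univ y) (mem_univ x)

end Global

/-! ## §2 The radial rows of `u″` and `u‴` -/

/-- **Order-2 radial-row constant of the radius** (`d = Dt_min − 2A`; `T = π√2`, `R₁ = klCurveR1`, `R₂ = klCurveR2`, `E₁ = 4+2A`, `E₂ = 4+4A`, `W₀ = 1/d`,
`W₁ = radialRowOneConst A d − 1/d`, `Δ₁ = (4+4A)/d`, `Δ₂ = (4+8A₃)/d`):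
`W₀ + (Δ₂(R₁+T)² + 2E₂(R₁+T)(W₁+W₀) + Δ₁(2R₁+T) + E₁(W₀+2W₁) + (R₂+T)Δ₁)/d`. -/
def uRowTwoConst (A A₃ d : ℝ) : ℝ :=
  1 / d + ((4 + 8 * A₃) / d * (klCurveR1 + π * Real.sqrt 2) ^ 2 +
    2 * (4 + 4 * A) * (klCurveR1 + π * Real.sqrt 2) * ((radialRowOneConst A d - 1 / d) + 1 / d) +
    (4 + 4 * A) / d * (2 * klCurveR1 + π * Real.sqrt 2) + (4 + 2 * A) * (1 / d + 2 * (radialRowOneConst A d - 1 / d)) +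
    (klCurveR2 + π * Real.sqrt 2) * ((4 + 4 * A) / d)) / d

/-- **Order-3 radial-row constant of the radius** (same abbreviations, `E₃ = 4+8A₃`, `Δ₃ = (4+16A₄)/d`, `R₃ = klCurveT3 A₃`, `W₂ = uRowTwoConst A A₃ d`,
`K₁ = R₁+T`, `K₂ = R₂+2R₁+T`):
`(Δ₃K₁³ + 3E₃(W₁+W₀)K₁² + 3(Δ₂K₁K₂ + E₂((W₂+2W₁+W₀)K₁ + K₂(W₁+W₀))) + Δ₁(3R₂+3R₁+T) + E₁(3W₂+3W₁+W₀) + R₃Δ₁)/d`. -/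
def uRowThreeConst (A A₃ A₄ d : ℝ) : ℝ :=
  ((4 + 16 * A₄) / d * (klCurveR1 + π * Real.sqrt 2) ^ 3 +
    3 * (4 + 8 * A₃) * ((radialRowOneConst A d - 1 / d) + 1 / d) * (klCurveR1 + π * Real.sqrt 2) ^ 2 +
    3 * ((4 + 8 * A₃) / d * (klCurveR1 + π * Real.sqrt 2) * (klCurveR2 + 2 * klCurveR1 + π * Real.sqrt 2) +
      (4 + 4 * A) * ((uRowTwoConst A A₃ d + 2 * (radialRowOneConst A d - 1 / d) + 1 / d) * (klCurveR1 + π * Real.sqrt 2) +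
        (klCurveR2 + 2 * klCurveR1 + π * Real.sqrt 2) * ((radialRowOneConst A d - 1 / d) + 1 / d))) +
    (4 + 4 * A) / d * (3 * klCurveR2 + 3 * klCurveR1 + π * Real.sqrt 2) +
    (4 + 2 * A) * (3 * uRowTwoConst A A₃ d + 3 * (radialRowOneConst A d - 1 / d) + 1 / d) +
    klCurveT3 A₃ * ((4 + 4 * A) / d)) / d

section Sizes

variable {K : TrigPolyC4v} {A : ℝ} (hA : ∀ p : Momentum, ∀ j ≤ 2, ‖iteratedFDeriv ℝ j (frameShift K) p‖ ≤ A) (hA20 : A ≤ 1 / 20)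
  (hd : klCurveD ≤ (bandBounds (show (-4 : ℝ) < -1.1 by norm_num) (show (-1.1 : ℝ) ≤ -0.1 by norm_num)
    (show (-0.1 : ℝ) < 0 by norm_num)).Dtmin - 2 * A)
  {μ r : ℝ} (hr : 0 < r) (hlo : (-1.1 : ℝ) < μ - r - A) (hhi : μ + r + A < -0.1)
  {A₃ A₄ : ℝ} (hA₃ : ∀ p : Momentum, ‖iteratedFDeriv ℝ 3 (frameShift K) p‖ ≤ A₃)
  (hA₄ : ∀ p : Momentum, ‖iteratedFDeriv ℝ 4 (frameShift K) p‖ ≤ A₄)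
include hA hA20 hd hr hlo hhi hA₃ hA₄

/-- **The radial rows of `u″` and `u‴`**: for `|ρ| < r` and every angle `s`,
`|u″(μ+ρ;s) − u″(μ;s)| ≤ uRowTwoConst A A₃ (Dt_min−2A)·|ρ|` and `|u‴(μ+ρ;s) − u‴(μ;s)| ≤ uRowThreeConst A A₃ A₄ (Dt_min−2A)·|ρ|`.
[cite: BenfattoGiulianiMastropietro2006, §2.4 Lemma 2.1 (2.40)–(2.41)] -/
theorem abs_deriv_two_three_frameRadius_level_sub_le {ρ : ℝ} (hρ : |ρ| < r) (s : ℝ) :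
    |deriv (deriv (perturbedFermiRadius (fun k : Fin 2 → ℝ => -K.eval k) (μ + ρ))) s -
        deriv (deriv (perturbedFermiRadius (fun k : Fin 2 → ℝ => -K.eval k) (μ + 0))) s| ≤
      uRowTwoConst A A₃ ((bandBounds (show (-4 : ℝ) < -1.1 by norm_num) (show (-1.1 : ℝ) ≤ -0.1 by norm_num) (show (-0.1 : ℝ) < 0 by norm_num)).Dtmin -
        2 * A) * |ρ| ∧
    |deriv (deriv (deriv (perturbedFermiRadius (fun k : Fin 2 → ℝ => -K.eval k) (μ + ρ)))) s -
        deriv (deriv (deriv (perturbedFermiRadius (fun k : Fin 2 → ℝ => -K.eval k) (μ + 0)))) s| ≤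
      uRowThreeConst A A₃ A₄ ((bandBounds (show (-4 : ℝ) < -1.1 by norm_num) (show (-1.1 : ℝ) ≤ -0.1 by norm_num)
        (show (-0.1 : ℝ) < 0 by norm_num)).Dtmin - 2 * A) * |ρ| := by
  set B := bandBounds (show (-4 : ℝ) < -1.1 by norm_num) (show (-1.1 : ℝ) ≤ -0.1 by norm_num) (show (-0.1 : ℝ) < 0 by norm_num) with hBdef
  set δK : (Fin 2 → ℝ) → ℝ := fun k => -K.eval k with hδK
  set e : (Fin 2 → ℝ) → ℝ := fun k => sqDispersion k + δK k with hedef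
  set d := B.Dtmin - 2 * A with hddef
  set T := π * Real.sqrt 2 with hTdef
  have hADt : 2 * A < B.Dtmin := by have := klCurveD_pos; linarith
  have hdpos : 0 < d := by rw [hddef]; linarith
  have hA0 : 0 ≤ A := (norm_nonneg _).trans (hA 0 0 (by norm_num))
  -- frame data
  have hC : ContDiff ℝ 4 δK := by rw [hδK, ← frameShift_toLp_eq_neg_eval]; exact contDiff_frameShift_toLp K
  have hδ : ∀ k : Fin 2 → ℝ, (∀ i, |k i| ≤ π) → |δK k| ≤ A := fun k _ => by
    simpa [hδK, frameShift_toLp] using abs_frameShift_toLp_le hA k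
  have hκ : ∀ k : Fin 2 → ℝ, (∀ i, |k i| ≤ π) → ‖fderiv ℝ δK k‖ ≤ 2 * A := fun k _ => by
    rw [hδK, ← frameShift_toLp_eq_neg_eval]; exact norm_fderiv_frameShift_toLp_le hA k
  have hκ₂ : ∀ k : Fin 2 → ℝ, (∀ i, |k i| ≤ π) → ‖fderiv ℝ (fderiv ℝ δK) k‖ ≤ 4 * A := fun k _ => by
    rw [hδK, ← frameShift_toLp_eq_neg_eval]; exact norm_fderiv_fderiv_frameShift_toLp_le hA k
  have hκ₃ : ∀ k : Fin 2 → ℝ, (∀ i, |k i| ≤ π) → ‖fderiv ℝ (fderiv ℝ (fderiv ℝ δK)) k‖ ≤ 8 * A₃ := fun k _ =>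
    norm_fderiv_three_frameShift_le hA₃ k
  have he : ContDiff ℝ 4 e := contDiff_pertBand hC
  -- the two levels
  have hρ1 := (abs_lt.1 hρ).1
  have hρ2 := (abs_lt.1 hρ).2
  have hl₂ : (-1.1 : ℝ) ≤ μ + ρ - A := by linarith
  have hh₂ : μ + ρ + A ≤ -0.1 := by linarith
  have hl₁ : (-1.1 : ℝ) ≤ μ + 0 - A := by linarith
  have hh₁ : μ + 0 + A ≤ -0.1 := by linarith
  have hroot₂ := isBandFermiRadius_klFermiRadius B hA hl₂ hh₂
  have hroot₁ := isBandFermiRadius_klFermiRadius B hA hl₁ hh₁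
  set u := perturbedFermiRadius δK (μ + 0) with hudef
  set v := perturbedFermiRadius δK (μ + ρ) with hvdef
  have hu4 : ContDiff ℝ 4 u := by have h := contDiff_klFermiRadius B hA hADt hl₁ hh₁ (m := 4); exact_mod_cast h
  have hv4 : ContDiff ℝ 4 v := by have h := contDiff_klFermiRadius B hA hADt hl₂ hh₂ (m := 4); exact_mod_cast h
  have hlev : ∀ ϑ, e (u ϑ • dir ϑ) = μ + 0 := fun ϑ => pertBand_level hroot₁ ϑ
  have hlev' : ∀ ϑ, e (v ϑ • dir ϑ) = μ + ρ := fun ϑ => pertBand_level hroot₂ ϑ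
  -- transversality and derivative sizes at the two curve points
  have hρ' : d ≤ fderiv ℝ e (v s • dir s) (dir s) := Dtmin_sub_le_fderiv_pertBand_dir B hδ hl₂ hh₂ hκ hroot₂ hC s
  have hE₁ : ‖fderiv ℝ e (u s • dir s)‖ ≤ 4 + 2 * A := norm_fderiv_pertBand_le hC hκ hroot₁ s
  have hE₂ : ‖fderiv ℝ (fderiv ℝ e) (u s • dir s)‖ ≤ 4 + 4 * A := norm_fderiv_two_pertBand_le hC hroot₁ hκ₂ s
  have hE₃ : ‖fderiv ℝ (fderiv ℝ (fderiv ℝ e)) (u s • dir s)‖ ≤ 4 + 8 * A₃ := norm_fderiv_three_pertBand_le hC hroot₁ hκ₃ s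
  -- the radii and their tower
  obtain ⟨-, hR₁u, hR₂u, hR₃u, -⟩ := frameRadius_tower_of_sizes hA hA20 hd hl₁ hh₁ hA₃ hA₄ s
  obtain ⟨-, hR₁v, hR₂v, -, -⟩ := frameRadius_tower_of_sizes hA hA20 hd hl₂ hh₂ hA₃ hA₄ s
  have hupos : 0 < u s := frameRadius_pos B hA hl₁ hh₁ s
  have hvpos : 0 < v s := frameRadius_pos B hA hl₂ hh₂ s
  have hU₀ : |u s| ≤ T := by rw [abs_of_pos hupos]; exact frameRadius_le B hA hl₁ hh₁ s
  have hU₀' : |v s| ≤ T := by rw [abs_of_pos hvpos]; exact frameRadius_le B hA hl₂ hh₂ s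
  -- the displacement of the curve point and the derivative differences
  have hW₀ : |v s - u s| ≤ 1 / d * |ρ| := by
    have h := norm_levelPoint_sub_levelPoint_le B hA hADt hlo hhi (ρ := ρ) (ρ' := 0) ⟨hρ1, hρ2⟩ ⟨by linarith, hr⟩ s
    rw [norm_levelPoint_sub_levelPoint, sub_zero] at h
    rw [one_div_mul_eq_div]; exact h
  have hdx : ‖v s • dir s - u s • dir s‖ ≤ 1 / d * |ρ| := by
    rw [← sub_smul, norm_smul, Real.norm_eq_abs]
    exact (mul_le_of_le_one_right (abs_nonneg _) (norm_dir_le_one s)).trans hW₀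
  have hΔ₁ : ‖fderiv ℝ e (v s • dir s) - fderiv ℝ e (u s • dir s)‖ ≤ (4 + 4 * A) / d * |ρ| := by
    refine (norm_fderiv_pertBandK_sub_le hA _ _).trans ?_
    calc (4 + 4 * A) * ‖v s • dir s - u s • dir s‖ ≤ (4 + 4 * A) * (1 / d * |ρ|) := mul_le_mul_of_nonneg_left hdx (by positivity)
      _ = (4 + 4 * A) / d * |ρ| := by ring
  have hΔ₂ : ‖fderiv ℝ (fderiv ℝ e) (v s • dir s) - fderiv ℝ (fderiv ℝ e) (u s • dir s)‖ ≤ (4 + 8 * A₃) / d * |ρ| := by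
    refine (norm_fderiv_two_pertBandK_sub_le hA₃ _ _).trans ?_
    have hA₃0 : 0 ≤ A₃ := (norm_nonneg _).trans (hA₃ 0)
    calc (4 + 8 * A₃) * ‖v s • dir s - u s • dir s‖ ≤ (4 + 8 * A₃) * (1 / d * |ρ|) := mul_le_mul_of_nonneg_left hdx (by positivity)
      _ = (4 + 8 * A₃) / d * |ρ| := by ring
  have hΔ₃ : ‖fderiv ℝ (fderiv ℝ (fderiv ℝ e)) (v s • dir s) - fderiv ℝ (fderiv ℝ (fderiv ℝ e)) (u s • dir s)‖ ≤ (4 + 16 * A₄) / d * |ρ| := by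
    refine (norm_fderiv_three_pertBandK_sub_le hA₄ _ _).trans ?_
    have hA₄0 : 0 ≤ A₄ := (norm_nonneg _).trans (hA₄ 0)
    calc (4 + 16 * A₄) * ‖v s • dir s - u s • dir s‖ ≤ (4 + 16 * A₄) * (1 / d * |ρ|) := mul_le_mul_of_nonneg_left hdx (by positivity)
      _ = (4 + 16 * A₄) / d * |ρ| := by ring
  have hW₁ : |deriv v s - deriv u s| ≤ (radialRowOneConst A d - 1 / d) * |ρ| := abs_deriv_frameRadius_level_sub_le hA hd hr hlo hhi hρ s
  -- order 2
  have h2 := abs_deriv_two_sub_le_of_polar_levels he he hu4 hv4 hlev hlev' hdpos hρ' hE₁ hE₂ hΔ₁ hΔ₂ hU₀ hU₀' hR₁u hR₁v hR₂u hW₀ hW₁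
  have h2' : |deriv (deriv v) s - deriv (deriv u) s| ≤ uRowTwoConst A A₃ d * |ρ| := by
    refine h2.trans (le_of_eq ?_)
    simp only [uRowTwoConst, hTdef]
    field_simp
  refine ⟨h2', ?_⟩
  -- order 3
  have h3 := abs_deriv_three_sub_le_of_polar_levels he he hu4 hv4 hlev hlev' hdpos hρ' hE₁ hE₂ hE₃ hΔ₁ hΔ₂ hΔ₃ hU₀ hU₀' hR₁u hR₁v hR₂u hR₂v
    hR₃u hW₀ hW₁ h2'
  refine h3.trans (le_of_eq ?_)
  simp only [uRowThreeConst, hTdef]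
  field_simp

omit hA20 hr hlo hhi hA₃ hA₄ in
/-- **The second angular derivative of a level curve in the moving frame**: `γ_ρ″(s) = toLp((u″ − u)·dir s + 2u′·dir(s+π/2))` (tube level). -/
theorem iteratedDeriv_two_levelPoint {ρ : ℝ} (hl : (-1.1 : ℝ) ≤ μ + ρ - A) (hh : μ + ρ + A ≤ -0.1) (s : ℝ) :
    iteratedDeriv 2 (levelPoint μ K ρ) s =
      WithLp.toLp 2 ((deriv (deriv (perturbedFermiRadius (fun k : Fin 2 → ℝ => -K.eval k) (μ + ρ))) s -
          perturbedFermiRadius (fun k : Fin 2 → ℝ => -K.eval k) (μ + ρ) s) • dir s +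
        (2 * deriv (perturbedFermiRadius (fun k : Fin 2 → ℝ => -K.eval k) (μ + ρ)) s) • dir (s + π / 2)) := by
  set B := bandBounds (show (-4 : ℝ) < -1.1 by norm_num) (show (-1.1 : ℝ) ≤ -0.1 by norm_num) (show (-0.1 : ℝ) < 0 by norm_num) with hBdef
  have hADt : 2 * A < B.Dtmin := by have := klCurveD_pos; linarith
  have hu4 : ContDiff ℝ 4 (perturbedFermiRadius (fun p : Fin 2 → ℝ => -K.eval p) (μ + ρ)) := by
    have h := contDiff_klFermiRadius B hA hADt hl hh (m := 4); exact_mod_cast h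
  have h1 : iteratedDeriv 1 (levelPoint μ K ρ) = ((EuclideanSpace.equiv (Fin 2) ℝ).symm : (Fin 2 → ℝ) →L[ℝ] Momentum) ∘
      fun t => deriv (perturbedFermiRadius (fun p : Fin 2 → ℝ => -K.eval p) (μ + ρ)) t • dir t +
        perturbedFermiRadius (fun p : Fin 2 → ℝ => -K.eval p) (μ + ρ) t • dir (t + π / 2) := by
    funext t; exact iteratedDeriv_one_levelPoint hA hd hl hh t
  have hsucc : iteratedDeriv 2 (levelPoint μ K ρ) = deriv (iteratedDeriv 1 (levelPoint μ K ρ)) := iteratedDeriv_succ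
  rw [hsucc, h1]
  exact (((EuclideanSpace.equiv (Fin 2) ℝ).symm : (Fin 2 → ℝ) →L[ℝ] Momentum).hasFDerivAt.comp_hasDerivAt s (hasDerivAt_polar_one hu4 s)).deriv

omit hA20 hr hlo hhi hA₃ hA₄ in
/-- **The third angular derivative of a level curve in the moving frame**: `γ_ρ‴(s) = toLp((u‴ − 3u′)·dir s + (3u″ − u)·dir(s+π/2))` (tube level). -/
theorem iteratedDeriv_three_levelPoint {ρ : ℝ} (hl : (-1.1 : ℝ) ≤ μ + ρ - A) (hh : μ + ρ + A ≤ -0.1) (s : ℝ) :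
    iteratedDeriv 3 (levelPoint μ K ρ) s =
      WithLp.toLp 2 ((deriv (deriv (deriv (perturbedFermiRadius (fun k : Fin 2 → ℝ => -K.eval k) (μ + ρ)))) s -
          3 * deriv (perturbedFermiRadius (fun k : Fin 2 → ℝ => -K.eval k) (μ + ρ)) s) • dir s +
        (3 * deriv (deriv (perturbedFermiRadius (fun k : Fin 2 → ℝ => -K.eval k) (μ + ρ))) s -
          perturbedFermiRadius (fun k : Fin 2 → ℝ => -K.eval k) (μ + ρ) s) • dir (s + π / 2)) := by
  set B := bandBounds (show (-4 : ℝ) < -1.1 by norm_num) (show (-1.1 : ℝ) ≤ -0.1 by norm_num) (show (-0.1 : ℝ) < 0 by norm_num) with hBdef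
  have hADt : 2 * A < B.Dtmin := by have := klCurveD_pos; linarith
  have hu4 : ContDiff ℝ 4 (perturbedFermiRadius (fun p : Fin 2 → ℝ => -K.eval p) (μ + ρ)) := by
    have h := contDiff_klFermiRadius B hA hADt hl hh (m := 4); exact_mod_cast h
  have h2 : iteratedDeriv 2 (levelPoint μ K ρ) = ((EuclideanSpace.equiv (Fin 2) ℝ).symm : (Fin 2 → ℝ) →L[ℝ] Momentum) ∘
      fun t => (deriv (deriv (perturbedFermiRadius (fun p : Fin 2 → ℝ => -K.eval p) (μ + ρ))) t -
          perturbedFermiRadius (fun p : Fin 2 → ℝ => -K.eval p) (μ + ρ) t) • dir t +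
        (2 * deriv (perturbedFermiRadius (fun p : Fin 2 → ℝ => -K.eval p) (μ + ρ)) t) • dir (t + π / 2) := by
    funext t; exact iteratedDeriv_two_levelPoint hA hd hl hh t
  have hsucc : iteratedDeriv 3 (levelPoint μ K ρ) = deriv (iteratedDeriv 2 (levelPoint μ K ρ)) := iteratedDeriv_succ
  rw [hsucc, h2]
  exact (((EuclideanSpace.equiv (Fin 2) ℝ).symm : (Fin 2 → ℝ) →L[ℝ] Momentum).hasFDerivAt.comp_hasDerivAt s (hasDerivAt_polar_two hu4 s)).deriv

/-- **ORDER-TWO RADIAL ROW of the co-moving chart**: `‖γ_ρ″(s) − γ₀″(s)‖ ≤ curveRowTwoConst·|ρ|` with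
`curveRowTwoConst = uRowTwoConst + 1/d + 2(radialRowOneConst − 1/d)` (`d = Dt_min − 2A`). [cite: BenfattoGiulianiMastropietro2006, §2.4 Lemma 2.1 (2.40)] -/
theorem norm_iteratedDeriv_two_levelPoint_sub_le {ρ : ℝ} (hρ : |ρ| < r) (s : ℝ) :
    ‖iteratedDeriv 2 (levelPoint μ K ρ) s - iteratedDeriv 2 (levelPoint μ K 0) s‖ ≤
      (uRowTwoConst A A₃ ((bandBounds (show (-4 : ℝ) < -1.1 by norm_num) (show (-1.1 : ℝ) ≤ -0.1 by norm_num) (show (-0.1 : ℝ) < 0 by norm_num)).Dtmin -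
          2 * A) +
        1 / ((bandBounds (show (-4 : ℝ) < -1.1 by norm_num) (show (-1.1 : ℝ) ≤ -0.1 by norm_num) (show (-0.1 : ℝ) < 0 by norm_num)).Dtmin - 2 * A) +
        2 * (radialRowOneConst A ((bandBounds (show (-4 : ℝ) < -1.1 by norm_num) (show (-1.1 : ℝ) ≤ -0.1 by norm_num)
          (show (-0.1 : ℝ) < 0 by norm_num)).Dtmin - 2 * A) -
          1 / ((bandBounds (show (-4 : ℝ) < -1.1 by norm_num) (show (-1.1 : ℝ) ≤ -0.1 by norm_num) (show (-0.1 : ℝ) < 0 by norm_num)).Dtmin -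
            2 * A))) * |ρ| := by
  set B := bandBounds (show (-4 : ℝ) < -1.1 by norm_num) (show (-1.1 : ℝ) ≤ -0.1 by norm_num) (show (-0.1 : ℝ) < 0 by norm_num) with hBdef
  set d := B.Dtmin - 2 * A with hddef
  set u := perturbedFermiRadius (fun k : Fin 2 → ℝ => -K.eval k) (μ + 0) with hudef
  set v := perturbedFermiRadius (fun k : Fin 2 → ℝ => -K.eval k) (μ + ρ) with hvdef
  have hADt : 2 * A < B.Dtmin := by have := klCurveD_pos; linarith
  have hρ1 := (abs_lt.1 hρ).1
  have hρ2 := (abs_lt.1 hρ).2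
  have hl₂ : (-1.1 : ℝ) ≤ μ + ρ - A := by linarith
  have hh₂ : μ + ρ + A ≤ -0.1 := by linarith
  have hl₁ : (-1.1 : ℝ) ≤ μ + 0 - A := by linarith
  have hh₁ : μ + 0 + A ≤ -0.1 := by linarith
  rw [iteratedDeriv_two_levelPoint hA hd hl₂ hh₂ s, iteratedDeriv_two_levelPoint hA hd hl₁ hh₁ s, ← WithLp.toLp_sub]
  have hsplit : (deriv (deriv v) s - v s) • dir s + (2 * deriv v s) • dir (s + π / 2) -
      ((deriv (deriv u) s - u s) • dir s + (2 * deriv u s) • dir (s + π / 2)) =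
      ((deriv (deriv v) s - deriv (deriv u) s) - (v s - u s)) • dir s + (2 * (deriv v s - deriv u s)) • dir (s + π / 2) := by
    simp only [sub_smul, mul_sub]; abel
  rw [hsplit]
  refine (norm_toLp_frame_comb_le _ _ _).trans ?_
  have hW₀ : |v s - u s| ≤ 1 / d * |ρ| := by
    have h := norm_levelPoint_sub_levelPoint_le B hA hADt hlo hhi (ρ := ρ) (ρ' := 0) ⟨hρ1, hρ2⟩ ⟨by linarith, hr⟩ s
    rw [norm_levelPoint_sub_levelPoint, sub_zero] at h
    rw [one_div_mul_eq_div]; exact h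
  have hW₁ : |deriv v s - deriv u s| ≤ (radialRowOneConst A d - 1 / d) * |ρ| := abs_deriv_frameRadius_level_sub_le hA hd hr hlo hhi hρ s
  have hW₂ := (abs_deriv_two_three_frameRadius_level_sub_le hA hA20 hd hr hlo hhi hA₃ hA₄ hρ s).1
  have h1 : |deriv (deriv v) s - deriv (deriv u) s - (v s - u s)| ≤ uRowTwoConst A A₃ d * |ρ| + 1 / d * |ρ| :=
    (abs_sub _ _).trans (add_le_add hW₂ hW₀)
  have h2 : |2 * (deriv v s - deriv u s)| ≤ 2 * ((radialRowOneConst A d - 1 / d) * |ρ|) := by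
    rw [abs_mul, abs_two]; exact mul_le_mul_of_nonneg_left hW₁ (by norm_num)
  calc _ ≤ uRowTwoConst A A₃ d * |ρ| + 1 / d * |ρ| + 2 * ((radialRowOneConst A d - 1 / d) * |ρ|) := add_le_add h1 h2
    _ = _ := by ring

/-- **ORDER-THREE RADIAL ROW of the co-moving chart**: `‖γ_ρ‴(s) − γ₀‴(s)‖ ≤ curveRowThreeConst·|ρ|` with
`curveRowThreeConst = uRowThreeConst + 3(radialRowOneConst − 1/d) + 3·uRowTwoConst + 1/d`. [cite: BenfattoGiulianiMastropietro2006, §2.4 Lemma 2.1 (2.40)] -/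
theorem norm_iteratedDeriv_three_levelPoint_sub_le {ρ : ℝ} (hρ : |ρ| < r) (s : ℝ) :
    ‖iteratedDeriv 3 (levelPoint μ K ρ) s - iteratedDeriv 3 (levelPoint μ K 0) s‖ ≤
      (uRowThreeConst A A₃ A₄ ((bandBounds (show (-4 : ℝ) < -1.1 by norm_num) (show (-1.1 : ℝ) ≤ -0.1 by norm_num)
          (show (-0.1 : ℝ) < 0 by norm_num)).Dtmin - 2 * A) +
        3 * (radialRowOneConst A ((bandBounds (show (-4 : ℝ) < -1.1 by norm_num) (show (-1.1 : ℝ) ≤ -0.1 by norm_num)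
          (show (-0.1 : ℝ) < 0 by norm_num)).Dtmin - 2 * A) -
          1 / ((bandBounds (show (-4 : ℝ) < -1.1 by norm_num) (show (-1.1 : ℝ) ≤ -0.1 by norm_num) (show (-0.1 : ℝ) < 0 by norm_num)).Dtmin -
            2 * A)) +
        3 * uRowTwoConst A A₃ ((bandBounds (show (-4 : ℝ) < -1.1 by norm_num) (show (-1.1 : ℝ) ≤ -0.1 by norm_num)
          (show (-0.1 : ℝ) < 0 by norm_num)).Dtmin - 2 * A) +
        1 / ((bandBounds (show (-4 : ℝ) < -1.1 by norm_num) (show (-1.1 : ℝ) ≤ -0.1 by norm_num) (show (-0.1 : ℝ) < 0 by norm_num)).Dtmin -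
          2 * A)) * |ρ| := by
  set B := bandBounds (show (-4 : ℝ) < -1.1 by norm_num) (show (-1.1 : ℝ) ≤ -0.1 by norm_num) (show (-0.1 : ℝ) < 0 by norm_num) with hBdef
  set d := B.Dtmin - 2 * A with hddef
  set u := perturbedFermiRadius (fun k : Fin 2 → ℝ => -K.eval k) (μ + 0) with hudef
  set v := perturbedFermiRadius (fun k : Fin 2 → ℝ => -K.eval k) (μ + ρ) with hvdef
  have hADt : 2 * A < B.Dtmin := by have := klCurveD_pos; linarith
  have hρ1 := (abs_lt.1 hρ).1
  have hρ2 := (abs_lt.1 hρ).2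
  have hl₂ : (-1.1 : ℝ) ≤ μ + ρ - A := by linarith
  have hh₂ : μ + ρ + A ≤ -0.1 := by linarith
  have hl₁ : (-1.1 : ℝ) ≤ μ + 0 - A := by linarith
  have hh₁ : μ + 0 + A ≤ -0.1 := by linarith
  rw [iteratedDeriv_three_levelPoint hA hd hl₂ hh₂ s, iteratedDeriv_three_levelPoint hA hd hl₁ hh₁ s, ← WithLp.toLp_sub]
  have hsplit : (deriv (deriv (deriv v)) s - 3 * deriv v s) • dir s + (3 * deriv (deriv v) s - v s) • dir (s + π / 2) -
      ((deriv (deriv (deriv u)) s - 3 * deriv u s) • dir s + (3 * deriv (deriv u) s - u s) • dir (s + π / 2)) =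
      ((deriv (deriv (deriv v)) s - deriv (deriv (deriv u)) s) - 3 * (deriv v s - deriv u s)) • dir s +
        (3 * (deriv (deriv v) s - deriv (deriv u) s) - (v s - u s)) • dir (s + π / 2) := by
    simp only [sub_smul, mul_sub]; abel
  rw [hsplit]
  refine (norm_toLp_frame_comb_le _ _ _).trans ?_
  have hW₀ : |v s - u s| ≤ 1 / d * |ρ| := by
    have h := norm_levelPoint_sub_levelPoint_le B hA hADt hlo hhi (ρ := ρ) (ρ' := 0) ⟨hρ1, hρ2⟩ ⟨by linarith, hr⟩ s
    rw [norm_levelPoint_sub_levelPoint, sub_zero] at h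
    rw [one_div_mul_eq_div]; exact h
  have hW₁ : |deriv v s - deriv u s| ≤ (radialRowOneConst A d - 1 / d) * |ρ| := abs_deriv_frameRadius_level_sub_le hA hd hr hlo hhi hρ s
  obtain ⟨hW₂, hW₃⟩ := abs_deriv_two_three_frameRadius_level_sub_le hA hA20 hd hr hlo hhi hA₃ hA₄ hρ s
  have h1 : |deriv (deriv (deriv v)) s - deriv (deriv (deriv u)) s - 3 * (deriv v s - deriv u s)| ≤
      uRowThreeConst A A₃ A₄ d * |ρ| + 3 * ((radialRowOneConst A d - 1 / d) * |ρ|) := by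
    refine (abs_sub _ _).trans (add_le_add hW₃ ?_)
    rw [abs_mul, abs_of_pos (by norm_num : (0 : ℝ) < 3)]; exact mul_le_mul_of_nonneg_left hW₁ (by norm_num)
  have h2 : |3 * (deriv (deriv v) s - deriv (deriv u) s) - (v s - u s)| ≤ 3 * (uRowTwoConst A A₃ d * |ρ|) + 1 / d * |ρ| := by
    refine (abs_sub _ _).trans (add_le_add ?_ hW₀)
    rw [abs_mul, abs_of_pos (by norm_num : (0 : ℝ) < 3)]; exact mul_le_mul_of_nonneg_left hW₂ (by norm_num)
  calc _ ≤ uRowThreeConst A A₃ A₄ d * |ρ| + 3 * ((radialRowOneConst A d - 1 / d) * |ρ|) + (3 * (uRowTwoConst A A₃ d * |ρ|) + 1 / d * |ρ|) :=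
        add_le_add h1 h2
    _ = _ := by ring

end Sizes

end Summit.HubbardSuperconductivity.HubbardSuperconductivity.Theorems.C4a

end
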